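import Summits.ValiantsHypothesis.Statement

/-!
# ValiantsHypothesis — hub lemma (permanent-based routes)

Item `stmt-ValiantsHypothesis-0317` (rank-1 hub shared by the routes Depth4, GCT, …): if the
permanent family over `ℂ` is not a `VP` family then `VP ℂ ≠ VNP ℂ`, given as hypotheses the
renaming bridge `perFamily ℂ ∈ VP ℂ ↔ IsVPFamily (fun n => perPoly (Fin n) ℂ)`
(`mem_VP_ofFintype_iff` instance) and Valiant's theorem `perFamily ℂ ∈ VNP ℂ`
(`Literature.Computability.AlgebraicComplexity.perFamily_mem_VNP`; Valiant 1979, Bürgisser 2000 Thm. 2.10). Pure bookkeeping.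
-/

namespace Summit.ValiantsHypothesis.Hub

/-- Settles stmt-ValiantsHypothesis-0317 (hub): `per ∉ VP` (as an `IsVPFamily` statement), the
renaming bridge and `per ∈ VNP` give Valiant's hypothesis `VP ℂ ≠ VNP ℂ`. [folklore] -/
theorem valiantsHypothesis_of_not_isVPFamily_per :
    ¬ Literature.Computability.AlgebraicComplexity.IsVPFamily (fun n => Literature.Computability.AlgebraicComplexity.perPoly (Fin n) ℂ) →
      (Literature.Computability.AlgebraicComplexity.perFamily ℂ ∈ Literature.Computability.AlgebraicComplexity.VP ℂ ↔
        Literature.Computability.AlgebraicComplexity.IsVPFamily (fun n => Literature.Computability.AlgebraicComplexity.perPoly (Fin n) ℂ)) →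
      Literature.Computability.AlgebraicComplexity.perFamily_mem_VNP ℂ → ValiantsHypothesis := by
  intro hnot hbridge hVNP
  show Literature.Computability.AlgebraicComplexity.VP ℂ ≠ Literature.Computability.AlgebraicComplexity.VNP ℂ
  intro hEq
  apply hnot
  have hper : Literature.Computability.AlgebraicComplexity.perFamily ℂ ∈ Literature.Computability.AlgebraicComplexity.VP ℂ := by rw [hEq]; exact hVNP
  exact hbridge.1 hper

end Summit.ValiantsHypothesis.Hub
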